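import Mathlib
import HarnessLib
import Summits.NavierStokesRegularity.NavierStokesRegularity.Theorems.UnthreadedDoorNetFluxDefs
import Summits.NavierStokesRegularity.NavierStokesRegularity.Theorems.UnthreadedDoorNetFluxSphereMinusFinite
import Summits.NavierStokesRegularity.NavierStokesRegularity.Theorems.UnthreadedDoorNetFluxAnalyticValueGluing

/-!
# Route `UnthreadedDoor`, crux `PoloidalLiouville` (stmt-NavierStokesRegularity-1222), WALL W1 — crux idea «height-head»:
# **K1⁺ `LevelLipschitzOfAnalyticIsolated` IS A THEOREM** (hence K1 `LevelLipschitzOfAnalyticMorse`)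

`levelLipschitz_of_analytic_finiteCrit`: on a round sphere `S_r(x₀)` (`r > 0`), if `f` and `μ` are REAL-ANALYTIC and `g` is `C¹`
off `x₀`, `∇g − μ∇f ∥ (x − x₀)` on `S` (the tangential head relation, carrying the loop law), `|μ| ≤ L` on `S`, and the set of
sphere-critical points `{x ∈ S : ∇f(x) × (x − x₀) = 0}` is FINITE, then `|g x − g y| ≤ L |f x − f y|` for all `x, y ∈ S`.
This is the statement `HeightHead.LevelLipschitzOfAnalyticIsolated` of ns-idea-14's sketch `Cruxes/PoloidalLiouville/HeightHeadSketch.lean`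
(v3.2, l.120) with its binders VERBATIM (`sphCrit f x₀ r` unfolded to its body), and it implies K1 `LevelLipschitzOfAnalyticMorse`
(`morse_of_isolated` in the sketch: non-degeneracy is simply not needed).

Proof (ARM A g4; no K1a jet lemma, no Milnor fibre, no Reeb graph): regular points first — `slice_le_of_analytic_regular`
(`…AnalyticValueGluing`, p678759: analytic level charts H1 p677791, chain of charts over the preconnected regular set, identity
theorem for the analytic chart derivatives, 1-D gluing, mean value), the regular set being preconnected because a round sphere minus
finitely many points is (`isPreconnected_sphere_diff_finite`, H2 p678489); then all points by density of the regular set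
(`sphere_subset_closure_diff_finite`) and continuity of both sides.  Analyticity is used ONLY at regular points (the card's `C^∞`
counterexample — a flat `μ` on one saddle sector — fails to be analytic along the saddle's separatrices, which are regular points).

HONEST FRAME: a lemma of pure real-analytic geometry on spheres; every height-head RUNG built on it stays CONDITIONAL on the NS
spatial-analyticity fact (`NSSpatialAnalyticity`, LR16 Thm 9.12) and on `AnalyticNormalisation`; `PoloidalLiouville` (1222), W1 and
NS regularity are NOT proved; W1 movement 0.  `--supports stmt-NavierStokesRegularity-1222 --as helper`.  [folklore]
-/

noncomputable section

-- the summit and its single sub-problem share the name (CONVENTIONS §1)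
set_option linter.dupNamespace false

open Set Function Filter Topology InnerProductSpace Metric
open scoped RealInnerProductSpace ContDiff

namespace Summit.NavierStokesRegularity.NavierStokesRegularity.Theorems.PoloidalLiouville.NetFlux

open Literature.Analysis Literature.Analysis.FluidPDE

/-- **K1⁺ (`HeightHead.LevelLipschitzOfAnalyticIsolated`, crux idea «height-head», ns-idea-14) — PROVED**: the slice
level-Lipschitz inequality on a round sphere for real-analytic `f, μ` with FINITE sphere-critical set (no non-degeneracy).  Binders
= the sketch's (v3.2 l.120) verbatim with `sphCrit` unfolded. [folklore] -/
theorem levelLipschitz_of_analytic_finiteCrit : ∀ (f g μ : E3 → ℝ) (x₀ : E3) (r L : ℝ), 0 < r →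
    AnalyticOnNhd ℝ f ({x₀}ᶜ : Set E3) → ContDiffOn ℝ 1 g ({x₀}ᶜ : Set E3) →
    AnalyticOnNhd ℝ μ ({x₀}ᶜ : Set E3) →
    (∀ x ∈ Metric.sphere x₀ r, cross (gradient g x - μ x • gradient f x) (x - x₀) = 0) →
    (∀ x ∈ Metric.sphere x₀ r, |μ x| ≤ L) →
    {x : E3 | x ∈ Metric.sphere x₀ r ∧ cross (gradient f x) (x - x₀) = 0}.Finite →
    ∀ x ∈ Metric.sphere x₀ r, ∀ y ∈ Metric.sphere x₀ r, |g x - g y| ≤ L * |f x - f y| := by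
  intro f g μ x₀ r L hr hf hg hμ hpar hL hfin x hx y hy
  set S : Set E3 := Metric.sphere x₀ r with hS
  set Crit : Set E3 := {x : E3 | x ∈ S ∧ cross (gradient f x) (x - x₀) = 0} with hCrit
  have hsub : S ⊆ ({x₀}ᶜ : Set E3) := fun z hz h0 => by
    rw [mem_singleton_iff] at h0
    have := mem_sphere_iff_norm.1 hz
    rw [h0, sub_self, norm_zero] at this
    exact hr.ne' this.symm
  -- the regular set is preconnected and dense in the sphere
  have hconn : IsPreconnected (S \ Crit) := isPreconnected_sphere_diff_finite x₀ hr hfin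
  have hdense : S ⊆ closure (S \ Crit) := sphere_subset_closure_diff_finite x₀ hr hfin
  -- the inequality on regular pairs
  have hreg : ∀ p ∈ (S \ Crit) ×ˢ (S \ Crit), |g p.1 - g p.2| ≤ L * |f p.1 - f p.2| := by
    rintro ⟨a, b⟩ ⟨⟨haS, haC⟩, ⟨hbS, hbC⟩⟩
    exact slice_le_of_analytic_regular hr hf hμ hg hpar hL hconn haS (fun h0 => haC ⟨haS, h0⟩) hbS
      (fun h0 => hbC ⟨hbS, h0⟩)
  -- continuity of both sides on `S × S`
  have hfc : ContinuousOn f S := (hf.continuousOn).mono hsub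
  have hgc : ContinuousOn g S := hg.continuousOn.mono hsub
  have hΦ : ContinuousOn (fun p : E3 × E3 => L * |f p.1 - f p.2| - |g p.1 - g p.2|) (S ×ˢ S) := by
    have h1 : ContinuousOn (fun p : E3 × E3 => f p.1) (S ×ˢ S) := hfc.comp continuous_fst.continuousOn fun p hp => hp.1
    have h2 : ContinuousOn (fun p : E3 × E3 => f p.2) (S ×ˢ S) := hfc.comp continuous_snd.continuousOn fun p hp => hp.2
    have h3 : ContinuousOn (fun p : E3 × E3 => g p.1) (S ×ˢ S) := hgc.comp continuous_fst.continuousOn fun p hp => hp.1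
    have h4 : ContinuousOn (fun p : E3 × E3 => g p.2) (S ×ˢ S) := hgc.comp continuous_snd.continuousOn fun p hp => hp.2
    exact (continuousOn_const.mul (h1.sub h2).abs).sub (h3.sub h4).abs
  -- pass to the limit at `(x, y)`
  have hmem : (x, y) ∈ closure ((S \ Crit) ×ˢ (S \ Crit)) := by
    rw [closure_prod_eq]; exact ⟨hdense hx, hdense hy⟩
  haveI : (𝓝[(S \ Crit) ×ˢ (S \ Crit)] (x, y)).NeBot := mem_closure_iff_nhdsWithin_neBot.1 hmem
  have htend : Tendsto (fun p : E3 × E3 => L * |f p.1 - f p.2| - |g p.1 - g p.2|) (𝓝[(S \ Crit) ×ˢ (S \ Crit)] (x, y))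
      (𝓝 (L * |f x - f y| - |g x - g y|)) :=
    ((hΦ (x, y) ⟨hx, hy⟩).mono (prod_mono (fun z hz => hz.1) (fun z hz => hz.1))).tendsto
  have hev : ∀ᶠ p in 𝓝[(S \ Crit) ×ˢ (S \ Crit)] (x, y), (0 : ℝ) ≤ L * |f p.1 - f p.2| - |g p.1 - g p.2| :=
    eventually_nhdsWithin_of_forall fun p hp => sub_nonneg.2 (hreg p hp)
  have h := ge_of_tendsto htend hev
  linarith

end Summit.NavierStokesRegularity.NavierStokesRegularity.Theorems.PoloidalLiouville.NetFlux

end
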